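import Summits.AtomisticToContinuum.Crystallization.Theorems.FrustratedLawDichotomyStrainedPatchHomLeafTableParamA

/-!
# Param-form leaf — soundness, integer/real bridge: the pulled-back gradient bound, the class/entry gradient identities, the radius bound, far labels

decomp-a2c hand-1 g23 (crux `AperiodicFrustratedLawGap`, stmt-AtomisticToContinuum-27623; critic row 882).  DEF-FREE apart from the proof-side
readings `Dz`, `nZ`, `PZ`, `Hm`.  ★ `entry_bound` (interval-sum-before-abs bound for an entry parameter, twin of `class_bound` with the extra `SC²`
scale), ★ `Hm_sum` / `G_sum` (the kernel's `H_cb` / `Σ_c c_ac H_cb` ARE the label sums `Σ_T D·n_c n_b` / `Σ_T D·P_a n_b`), `AE_bound`,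
★ `rv_le` (the theorem's radius `r_v ≤ radP/SC`), ★ `abs_q_sub_ell0_le` + `far_of_farBP` (far labels by the param enclosure).  0 sorry; standard axioms.
`--supports stmt-AtomisticToContinuum-27623`.
-/

noncomputable section

namespace Summit.AtomisticToContinuum.Crystallization.Theorems.FrustratedLawDichotomyStrainedPatchHomLeafTableCheck

open scoped BigOperators RealInnerProductSpace
open Literature.Analysis.ValidatedNumerics.Numerics
open Summit.AtomisticToContinuum.Crystallization.Theorems.ChargedEnergyGapNegative (E3)
open Summit.AtomisticToContinuum.Crystallization.Theorems.FrustratedLawDichotomyStrainedPatchHomSplit (latPt)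
open Summit.AtomisticToContinuum.Crystallization.Theorems.FrustratedLawDichotomyStrainedPatchHomGram (norm_sq_latPt_eq_sum_gram)
open Literature.Barriers.AtomisticToContinuum.FlatleyTheil2015 (fccVec)

/-! ## §1. Proof-side readings -/

/-- The signed derivative midpoint of the row used for a record. -/
def Dz (tab : QT) (k : LK) (l : NL) : ℤ := sgnZ (rowT tab k l).sD (rowT tab k l).aD

/-- The record's `n`-vector `(n0, n1, n2)`. -/
def nZ (l : NL) (c : Fin 3) : ℤ := ![n0 l, n1 l, n2 l] c

/-- The record's `P`-vector `(P0, P1, P2)` against an entry record. -/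
def PZ (e : EP) (l : NL) (a : Fin 3) : ℤ := ![P0 e l, P1 e l, P2 e l] a

/-- The kernel's `H` matrix (symmetric). -/
def Hm (a : Acc) (c b : Fin 3) : ℤ := ![![H00 a, H01 a, H02 a], ![H01 a, H11 a, H12 a], ![H02 a, H12 a, H22 a]] c b

/-- `nZ = nLab ∘ toLab`. [formal bookkeeping] -/
theorem nZ_eq (l : NL) (c : Fin 3) : nZ l c = nLab l.toLab c := by
  fin_cases c <;> simp [nZ, nLab, NL.toLab, n0, n1, n2]

/-- `PZ (epOf c w) l a = Σ_cc c_(a,cc) · n_cc` in `ℝ`. [formal bookkeeping] -/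
theorem PZ_cast (c w : Fin 3 × Fin 3 → ℤ) (l : NL) (a : Fin 3) :
    ((PZ (epOf c w) l a : ℤ) : ℝ) = ∑ cc : Fin 3, (c (a, cc) : ℝ) * (nLab l.toLab cc : ℝ) := by
  obtain ⟨h0, h1, h2⟩ := P_cast c w l
  fin_cases a
  · simpa [PZ] using h0
  · simpa [PZ] using h1
  · simpa [PZ] using h2

/-- `PZ e l a = e-row a · n` in `ℤ`. [formal bookkeeping] -/
theorem PZ_eq (e : EP) (l : NL) (a : Fin 3) :
    PZ e l a = ![e.c00, e.c10, e.c20] a * nZ l 0 + ![e.c01, e.c11, e.c21] a * nZ l 1 + ![e.c02, e.c12, e.c22] a * nZ l 2 := by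
  fin_cases a <;> simp [PZ, P0, P1, P2, nZ, Int.add_def, Int.mul_def]

/-! ## §2. List-sum algebra -/

/-- Three-term linear combination of list sums. [formal bookkeeping] -/
theorem sum_lin3 (f g h : NL → ℤ) (x y z : ℤ) : ∀ (T : List NL),
    x * (T.map f).sum + y * (T.map g).sum + z * (T.map h).sum = (T.map fun l => x * f l + y * g l + z * h l).sum
  | [] => by simp
  | l :: T => by rw [List.map_cons, List.map_cons, List.map_cons, List.map_cons, List.sum_cons, List.sum_cons, List.sum_cons, List.sum_cons,
      ← sum_lin3 f g h x y z T]; ring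

/-- Four-term linear combination of list sums. [formal bookkeeping] -/
theorem sum_lin4 (f g h i : NL → ℤ) (x y z t : ℤ) : ∀ (T : List NL),
    x * (T.map f).sum + y * (T.map g).sum + z * (T.map h).sum + t * (T.map i).sum = (T.map fun l => x * f l + y * g l + z * h l + t * i l).sum
  | [] => by simp
  | l :: T => by rw [List.map_cons, List.map_cons, List.map_cons, List.map_cons, List.map_cons, List.sum_cons, List.sum_cons, List.sum_cons,
      List.sum_cons, List.sum_cons, ← sum_lin4 f g h i x y z t T]; ring

/-- Three-term linear combination of list sums in `ℕ`. [formal bookkeeping] -/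
theorem sum_lin3_nat (f g h : NL → ℕ) (x y z : ℕ) : ∀ (T : List NL),
    x * (T.map f).sum + y * (T.map g).sum + z * (T.map h).sum = (T.map fun l => x * f l + y * g l + z * h l).sum
  | [] => by simp
  | l :: T => by rw [List.map_cons, List.map_cons, List.map_cons, List.map_cons, List.sum_cons, List.sum_cons, List.sum_cons, List.sum_cons,
      ← sum_lin3_nat f g h x y z T]; ring

/-! ## §3. The class and entry gradient identities -/

/-- ★ **`H_cb` IS `Σ_T D·n_c n_b`**, given the six class-gradient identities of `acc_sumsR`. [formal bookkeeping] -/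
theorem Hm_sum {tab : QT} {k : LK} {a : Acc} (T : List NL) (hok : ∀ l ∈ T, l.ok = true)
    (e0 : ((a.g0P : ℕ) : ℤ) - a.g0N = (T.map (fun l => Dz tab k l * (l.m00 : ℤ))).sum)
    (e1 : ((a.g1P : ℕ) : ℤ) - a.g1N = (T.map (fun l => Dz tab k l * (l.m11 : ℤ))).sum)
    (e2 : ((a.g2P : ℕ) : ℤ) - a.g2N = (T.map (fun l => Dz tab k l * (l.m22 : ℤ))).sum)
    (e3 : ((a.g3P : ℕ) : ℤ) - a.g3N = (T.map (fun l => Dz tab k l * sgnZ l.s01 l.m01)).sum)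
    (e4 : ((a.g4P : ℕ) : ℤ) - a.g4N = (T.map (fun l => Dz tab k l * sgnZ l.s02 l.m02)).sum)
    (e5 : ((a.g5P : ℕ) : ℤ) - a.g5N = (T.map (fun l => Dz tab k l * sgnZ l.s12 l.m12)).sum) (c b : Fin 3) :
    Hm a c b = (T.map (fun l => Dz tab k l * (nZ l c * nZ l b))).sum := by
  have g0 : gZ a.g0P a.g0N = (T.map (fun l => Dz tab k l * (l.m00 : ℤ))).sum := by rw [gZ, Int.subNatNat_eq_coe]; exact e0
  have g1 : gZ a.g1P a.g1N = (T.map (fun l => Dz tab k l * (l.m11 : ℤ))).sum := by rw [gZ, Int.subNatNat_eq_coe]; exact e1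
  have g2 : gZ a.g2P a.g2N = (T.map (fun l => Dz tab k l * (l.m22 : ℤ))).sum := by rw [gZ, Int.subNatNat_eq_coe]; exact e2
  have g3 : gZ a.g3P a.g3N = (T.map (fun l => Dz tab k l * sgnZ l.s01 l.m01)).sum := by rw [gZ, Int.subNatNat_eq_coe]; exact e3
  have g4 : gZ a.g4P a.g4N = (T.map (fun l => Dz tab k l * sgnZ l.s02 l.m02)).sum := by rw [gZ, Int.subNatNat_eq_coe]; exact e4
  have g5 : gZ a.g5P a.g5N = (T.map (fun l => Dz tab k l * sgnZ l.s12 l.m12)).sum := by rw [gZ, Int.subNatNat_eq_coe]; exact e5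
  -- per-record class data in terms of the label
  have hrec : ∀ l ∈ T, (l.m00 : ℤ) = l.b0 * l.b0 ∧ (l.m11 : ℤ) = l.b1 * l.b1 ∧ (l.m22 : ℤ) = l.b2 * l.b2 ∧
      sgnZ l.s01 l.m01 = l.b0 * l.b1 ∧ sgnZ l.s02 l.m02 = l.b0 * l.b2 ∧ sgnZ l.s12 l.m12 = l.b1 * l.b2 :=
    fun l hl => ((NL.ok_iff l).1 (hok l hl)).2
  fin_cases c <;> fin_cases b <;>
    simp only [Hm, H00, H01, H02, H11, H12, H22, Matrix.cons_val_zero, Matrix.cons_val_one, Matrix.cons_val_two, Matrix.head_cons,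
      Matrix.tail_cons, Fin.isValue, Fin.mk_one, Fin.reduceFinMk, Fin.zero_eta, Int.add_def, Int.mul_def, g0, g1, g2, g3, g4, g5, nZ, n0, n1, n2]
  -- (0,0): g1 + g2 + 2 g5 = Σ D (b1+b2)²
  · have := sum_lin3 (fun l => Dz tab k l * (l.m11 : ℤ)) (fun l => Dz tab k l * (l.m22 : ℤ)) (fun l => Dz tab k l * sgnZ l.s12 l.m12) 1 1 2 T
    rw [one_mul, one_mul] at this; rw [this]
    congr 1; refine List.map_congr_left fun l hl => ?_
    obtain ⟨-, h11, h22, -, -, h12⟩ := hrec l hl; rw [h11, h22, h12]; ring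
  · have := sum_lin4 (fun l => Dz tab k l * sgnZ l.s01 l.m01) (fun l => Dz tab k l * sgnZ l.s02 l.m02) (fun l => Dz tab k l * sgnZ l.s12 l.m12)
      (fun l => Dz tab k l * (l.m22 : ℤ)) 1 1 1 1 T
    rw [one_mul, one_mul, one_mul, one_mul] at this; rw [this]
    congr 1; refine List.map_congr_left fun l hl => ?_
    obtain ⟨-, -, h22, h01, h02, h12⟩ := hrec l hl; rw [h22, h01, h02, h12]; ring
  · have := sum_lin4 (fun l => Dz tab k l * sgnZ l.s01 l.m01) (fun l => Dz tab k l * sgnZ l.s02 l.m02) (fun l => Dz tab k l * sgnZ l.s12 l.m12)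
      (fun l => Dz tab k l * (l.m11 : ℤ)) 1 1 1 1 T
    rw [one_mul, one_mul, one_mul, one_mul] at this; rw [this]
    congr 1; refine List.map_congr_left fun l hl => ?_
    obtain ⟨-, h11, -, h01, h02, h12⟩ := hrec l hl; rw [h11, h01, h02, h12]; ring
  · have := sum_lin4 (fun l => Dz tab k l * sgnZ l.s01 l.m01) (fun l => Dz tab k l * sgnZ l.s02 l.m02) (fun l => Dz tab k l * sgnZ l.s12 l.m12)
      (fun l => Dz tab k l * (l.m22 : ℤ)) 1 1 1 1 T
    rw [one_mul, one_mul, one_mul, one_mul] at this; rw [this]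
    congr 1; refine List.map_congr_left fun l hl => ?_
    obtain ⟨-, -, h22, h01, h02, h12⟩ := hrec l hl; rw [h22, h01, h02, h12]; ring
  · have := sum_lin3 (fun l => Dz tab k l * (l.m00 : ℤ)) (fun l => Dz tab k l * (l.m22 : ℤ)) (fun l => Dz tab k l * sgnZ l.s02 l.m02) 1 1 2 T
    rw [one_mul, one_mul] at this; rw [this]
    congr 1; refine List.map_congr_left fun l hl => ?_
    obtain ⟨h00, -, h22, -, h02, -⟩ := hrec l hl; rw [h00, h22, h02]; ring
  · have := sum_lin4 (fun l => Dz tab k l * (l.m00 : ℤ)) (fun l => Dz tab k l * sgnZ l.s01 l.m01) (fun l => Dz tab k l * sgnZ l.s02 l.m02)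
      (fun l => Dz tab k l * sgnZ l.s12 l.m12) 1 1 1 1 T
    rw [one_mul, one_mul, one_mul, one_mul] at this; rw [this]
    congr 1; refine List.map_congr_left fun l hl => ?_
    obtain ⟨h00, -, -, h01, h02, h12⟩ := hrec l hl; rw [h00, h01, h02, h12]; ring
  · have := sum_lin4 (fun l => Dz tab k l * sgnZ l.s01 l.m01) (fun l => Dz tab k l * sgnZ l.s02 l.m02) (fun l => Dz tab k l * sgnZ l.s12 l.m12)
      (fun l => Dz tab k l * (l.m11 : ℤ)) 1 1 1 1 T
    rw [one_mul, one_mul, one_mul, one_mul] at this; rw [this]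
    congr 1; refine List.map_congr_left fun l hl => ?_
    obtain ⟨-, h11, -, h01, h02, h12⟩ := hrec l hl; rw [h11, h01, h02, h12]; ring
  · have := sum_lin4 (fun l => Dz tab k l * (l.m00 : ℤ)) (fun l => Dz tab k l * sgnZ l.s01 l.m01) (fun l => Dz tab k l * sgnZ l.s02 l.m02)
      (fun l => Dz tab k l * sgnZ l.s12 l.m12) 1 1 1 1 T
    rw [one_mul, one_mul, one_mul, one_mul] at this; rw [this]
    congr 1; refine List.map_congr_left fun l hl => ?_
    obtain ⟨h00, -, -, h01, h02, h12⟩ := hrec l hl; rw [h00, h01, h02, h12]; ring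
  · have := sum_lin3 (fun l => Dz tab k l * (l.m00 : ℤ)) (fun l => Dz tab k l * (l.m11 : ℤ)) (fun l => Dz tab k l * sgnZ l.s01 l.m01) 1 1 2 T
    rw [one_mul, one_mul] at this; rw [this]
    congr 1; refine List.map_congr_left fun l hl => ?_
    obtain ⟨h00, h11, -, h01, -, -⟩ := hrec l hl; rw [h00, h11, h01]; ring

/-- ★ **`Σ_c c_ac H_cb` IS `Σ_T D·P_a n_b`**. [formal bookkeeping] -/
theorem G_sum {tab : QT} {k : LK} {a : Acc} {T : List NL} (e : EP)
    (hH : ∀ c b : Fin 3, Hm a c b = (T.map (fun l => Dz tab k l * (nZ l c * nZ l b))).sum) (aa bb : Fin 3) :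
    ![e.c00, e.c10, e.c20] aa * Hm a 0 bb + ![e.c01, e.c11, e.c21] aa * Hm a 1 bb + ![e.c02, e.c12, e.c22] aa * Hm a 2 bb =
      (T.map (fun l => Dz tab k l * (PZ e l aa * nZ l bb))).sum := by
  rw [hH 0 bb, hH 1 bb, hH 2 bb, sum_lin3]
  congr 1; refine List.map_congr_left fun l _ => ?_
  rw [PZ_eq]; ring

/-- The `E`-coefficient bound: `Σ_T |P_a n_b| ≤ Σ_c |c_ac|·AN_cb`. [formal bookkeeping] -/
theorem AE_bound {T : List NL} (e : EP) (AN : Fin 3 → Fin 3 → ℕ)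
    (hAN : ∀ c b : Fin 3, (T.map (fun l => (nZ l c * nZ l b).natAbs)).sum ≤ AN c b) (aa bb : Fin 3) :
    (T.map (fun l => (PZ e l aa * nZ l bb).natAbs)).sum ≤
      (![e.c00, e.c10, e.c20] aa).natAbs * AN 0 bb + (![e.c01, e.c11, e.c21] aa).natAbs * AN 1 bb + (![e.c02, e.c12, e.c22] aa).natAbs * AN 2 bb := by
  have hterm : ∀ l ∈ T, (PZ e l aa * nZ l bb).natAbs ≤
      (![e.c00, e.c10, e.c20] aa).natAbs * (nZ l 0 * nZ l bb).natAbs + (![e.c01, e.c11, e.c21] aa).natAbs * (nZ l 1 * nZ l bb).natAbs +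
        (![e.c02, e.c12, e.c22] aa).natAbs * (nZ l 2 * nZ l bb).natAbs := by
    intro l _
    rw [PZ_eq]
    have e1 : (![e.c00, e.c10, e.c20] aa * nZ l 0 + ![e.c01, e.c11, e.c21] aa * nZ l 1 + ![e.c02, e.c12, e.c22] aa * nZ l 2) * nZ l bb =
        ![e.c00, e.c10, e.c20] aa * (nZ l 0 * nZ l bb) + ![e.c01, e.c11, e.c21] aa * (nZ l 1 * nZ l bb) + ![e.c02, e.c12, e.c22] aa * (nZ l 2 * nZ l bb) := by
      ring
    rw [e1]
    refine (Int.natAbs_add_le _ _).trans (Nat.add_le_add ((Int.natAbs_add_le _ _).trans (Nat.add_le_add ?_ ?_)) ?_) <;>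
      rw [Int.natAbs_mul]
  refine (List.sum_le_sum hterm).trans ?_
  rw [← sum_lin3_nat]
  exact Nat.add_le_add (Nat.add_le_add (Nat.mul_le_mul_left _ (hAN 0 bb)) (Nat.mul_le_mul_left _ (hAN 1 bb))) (Nat.mul_le_mul_left _ (hAN 2 bb))

/-! ## §4. The pulled-back gradient bound (one entry parameter) -/

open Classical in
/-- ★ **ONE ENTRY PARAMETER**: the interval-sum-before-abs bound for a parameter whose pulled-back functional is `L′_l = cls_l / SC` (integer `cls`),
given `Gz = Σ_T D·cls` and `Σ_T |cls| ≤ AE`. [folklore] -/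
theorem entry_bound {tab : QT} {k : LK} {E : ℕ} (T : List NL) (hTnd : T.Nodup) (L : NL → ℝ) (cls : NL → ℤ) (Gz : ℤ) (AE : ℕ)
    (hL : ∀ l ∈ T, L l = ((cls l : ℤ) : ℝ) / SC)
    (eG : Gz = (T.map (fun l => Dz tab k l * cls l)).sum) (hAE : (T.map (fun l => (cls l).natAbs)).sum ≤ AE) :
    max |∑ l ∈ T.toFinset, min (((sgnZ (rowT tab k l).sD (rowT tab k l).aD - (E : ℤ) : ℤ) : ℝ) / SC * L l)
          (((sgnZ (rowT tab k l).sD (rowT tab k l).aD + (E : ℤ) : ℤ) : ℝ) / SC * L l)|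
        |∑ l ∈ T.toFinset, max (((sgnZ (rowT tab k l).sD (rowT tab k l).aD - (E : ℤ) : ℤ) : ℝ) / SC * L l)
          (((sgnZ (rowT tab k l).sD (rowT tab k l).aD + (E : ℤ) : ℤ) : ℝ) / SC * L l)| ≤
      ((Gz.natAbs + E * AE : ℕ) : ℝ) / SC ^ 2 := by
  classical
  have hS := SC_pos
  have hE : (0:ℝ) ≤ (E : ℝ) / SC := div_nonneg (by exact_mod_cast Nat.zero_le E) hS.le
  have hband : ∀ l ∈ T.toFinset,
      min (((sgnZ (rowT tab k l).sD (rowT tab k l).aD - (E : ℤ) : ℤ) : ℝ) / SC * L l)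
          (((sgnZ (rowT tab k l).sD (rowT tab k l).aD + (E : ℤ) : ℤ) : ℝ) / SC * L l) =
        ((Dz tab k l : ℤ) : ℝ) / SC * L l - (E : ℝ) / SC * |L l| ∧
      max (((sgnZ (rowT tab k l).sD (rowT tab k l).aD - (E : ℤ) : ℤ) : ℝ) / SC * L l)
          (((sgnZ (rowT tab k l).sD (rowT tab k l).aD + (E : ℤ) : ℤ) : ℝ) / SC * L l) =
        ((Dz tab k l : ℤ) : ℝ) / SC * L l + (E : ℝ) / SC * |L l| := by
    intro l _
    have h := min_max_band (((Dz tab k l : ℤ) : ℝ) / SC) ((E : ℝ) / SC) (L l) hE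
    have e1 : ((sgnZ (rowT tab k l).sD (rowT tab k l).aD - (E : ℤ) : ℤ) : ℝ) / SC = ((Dz tab k l : ℤ) : ℝ) / SC - (E : ℝ) / SC := by
      unfold Dz; push_cast; ring
    have e2 : ((sgnZ (rowT tab k l).sD (rowT tab k l).aD + (E : ℤ) : ℤ) : ℝ) / SC = ((Dz tab k l : ℤ) : ℝ) / SC + (E : ℝ) / SC := by
      unfold Dz; push_cast; ring
    rw [e1, e2]; exact h
  rw [Finset.sum_congr rfl fun l hl => (hband l hl).1, Finset.sum_congr rfl fun l hl => (hband l hl).2,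
    Finset.sum_sub_distrib, Finset.sum_add_distrib]
  have hG : ∑ l ∈ T.toFinset, ((Dz tab k l : ℤ) : ℝ) / SC * L l = ((Gz : ℤ) : ℝ) / SC ^ 2 := by
    have : ∀ l ∈ T.toFinset, ((Dz tab k l : ℤ) : ℝ) / SC * L l = ((Dz tab k l * cls l : ℤ) : ℝ) / SC ^ 2 := by
      intro l hl; rw [hL l (List.mem_toFinset.1 hl)]; push_cast; field_simp
    rw [Finset.sum_congr rfl this, ← Finset.sum_div, List.sum_toFinset _ hTnd, cast_list_sum_int, ← eG]
  have hA : ∑ l ∈ T.toFinset, (E : ℝ) / SC * |L l| = (E : ℝ) / SC * ((((T.map (fun l => (cls l).natAbs)).sum : ℕ) : ℝ) / SC) := by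
    have : ∀ l ∈ T.toFinset, (E : ℝ) / SC * |L l| = (E : ℝ) / SC * ((((cls l).natAbs : ℕ) : ℝ) / SC) := by
      intro l hl; rw [hL l (List.mem_toFinset.1 hl), abs_div, abs_of_pos hS, Nat.cast_natAbs, Int.cast_abs]
    rw [Finset.sum_congr rfl this, ← Finset.mul_sum, ← Finset.sum_div, List.sum_toFinset _ hTnd, cast_list_sum_nat]
  rw [hG, hA]
  have hAE' : (((T.map (fun l => (cls l).natAbs)).sum : ℕ) : ℝ) ≤ AE := by exact_mod_cast hAE
  have habsG : |((Gz : ℤ) : ℝ)| = ((Gz.natAbs : ℕ) : ℝ) := by rw [Nat.cast_natAbs, Int.cast_abs]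
  have hnn : 0 ≤ (E : ℝ) / SC * ((((T.map (fun l => (cls l).natAbs)).sum : ℕ) : ℝ) / SC) := by positivity
  have hS2 : (0 : ℝ) < (SC : ℝ) ^ 2 := by positivity
  have hEA : (E : ℝ) / SC * ((((T.map (fun l => (cls l).natAbs)).sum : ℕ) : ℝ) / SC) ≤ (E : ℝ) * AE / SC ^ 2 := by
    have := mul_le_mul_of_nonneg_left hAE' (show (0:ℝ) ≤ (E : ℝ) by exact_mod_cast Nat.zero_le E)
    rw [show (E : ℝ) / SC * ((((T.map (fun l => (cls l).natAbs)).sum : ℕ) : ℝ) / SC) =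
      (E : ℝ) * (((T.map (fun l => (cls l).natAbs)).sum : ℕ) : ℝ) / SC ^ 2 by field_simp]
    exact div_le_div_of_nonneg_right this hS2.le
  have e : ((Gz.natAbs + E * AE : ℕ) : ℝ) / SC ^ 2 = ((Gz.natAbs : ℕ) : ℝ) / SC ^ 2 + (E : ℝ) * AE / SC ^ 2 := by push_cast; ring
  rw [e]
  have h1 : |((Gz : ℤ) : ℝ) / SC ^ 2 - (E : ℝ) / SC * ((((T.map (fun l => (cls l).natAbs)).sum : ℕ) : ℝ) / SC)| ≤
      ((Gz.natAbs : ℕ) : ℝ) / SC ^ 2 + (E : ℝ) * AE / SC ^ 2 := by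
    refine (abs_sub _ _).trans ?_
    rw [abs_div, habsG, abs_of_pos hS2, abs_of_nonneg hnn]; linarith
  have h2 : |((Gz : ℤ) : ℝ) / SC ^ 2 + (E : ℝ) / SC * ((((T.map (fun l => (cls l).natAbs)).sum : ℕ) : ℝ) / SC)| ≤
      ((Gz.natAbs : ℕ) : ℝ) / SC ^ 2 + (E : ℝ) * AE / SC ^ 2 := by
    refine (abs_add_le _ _).trans ?_
    rw [abs_div, habsG, abs_of_pos hS2, abs_of_nonneg hnn]; linarith
  exact max_le h1 h2

/-! ## §5. The radius bound and far labels -/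

/-- Generic parametrised enclosure of a linear functional: `|Σᵢ Lᵢ cᵢ − Σᵢ Lᵢ c₀ᵢ| ≤ Σₖ |Σᵢ Lᵢ Jₖᵢ| hwₖ + Σᵢ |Lᵢ| ρᵢ`. [folklore] -/
theorem abs_lin_param_le {n q : ℕ} (L c c₀ ρ : Fin n → ℝ) (J : Fin q → Fin n → ℝ) (u hw : Fin q → ℝ)
    (hu : ∀ k, |u k| ≤ hw k) (he : ∀ i, |c i - c₀ i - ∑ k, J k i * u k| ≤ ρ i) :
    |∑ i, L i * c i - ∑ i, L i * c₀ i| ≤ ∑ k, |∑ i, L i * J k i| * hw k + ∑ i, |L i| * ρ i := by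
  set e : Fin n → ℝ := fun i => c i - c₀ i - ∑ k, J k i * u k with hedef
  have hsplit : ∑ i, L i * c i - ∑ i, L i * c₀ i = ∑ k, (∑ i, L i * J k i) * u k + ∑ i, L i * e i := by
    have h1 : ∀ i, c i - c₀ i = ∑ k, J k i * u k + e i := fun i => by simp only [hedef]; ring
    calc ∑ i, L i * c i - ∑ i, L i * c₀ i = ∑ i, L i * (c i - c₀ i) := by rw [← Finset.sum_sub_distrib]; simp only [mul_sub]
      _ = ∑ i, L i * (∑ k, J k i * u k + e i) := Finset.sum_congr rfl fun i _ => by rw [h1 i]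
      _ = ∑ i, (∑ k, L i * (J k i * u k)) + ∑ i, L i * e i := by
          rw [← Finset.sum_add_distrib]; exact Finset.sum_congr rfl fun i _ => by rw [mul_add, Finset.mul_sum]
      _ = ∑ k, (∑ i, L i * J k i) * u k + ∑ i, L i * e i := by
          congr 1; rw [Finset.sum_comm]; exact Finset.sum_congr rfl fun k _ => by rw [Finset.sum_mul]; exact Finset.sum_congr rfl fun i _ => by ring
  rw [hsplit]
  refine (abs_add_le _ _).trans (add_le_add ?_ ?_)
  · refine (Finset.abs_sum_le_sum_abs _ _).trans (Finset.sum_le_sum fun k _ => ?_)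
    rw [abs_mul]; exact mul_le_mul_of_nonneg_left (hu k) (abs_nonneg _)
  · refine (Finset.abs_sum_le_sum_abs _ _).trans (Finset.sum_le_sum fun i _ => ?_)
    rw [abs_mul]; exact mul_le_mul_of_nonneg_left (he i) (abs_nonneg _)

/-- `GB.wz (gbP c w) = rhoP w` and `GB.cz (gbP c w) = (cG c).toNat`. [formal bookkeeping] -/
theorem gbP_wz_cz (c w : Fin 3 × Fin 3 → ℤ) (i j : Fin 3) :
    (gbP c w).wz i j = rhoP w i j ∧ (gbP c w).cz i j = (cG c i j).toNat := by
  fin_cases i <;> fin_cases j <;> simp [GB.wz, GB.cz, gbP]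

/-- The `cz` entries of `gbP` read in `ℝ` under the guard `cenOKP`. [formal bookkeeping] -/
theorem gbP_cz_cast {c : Fin 3 × Fin 3 → ℤ} (w : Fin 3 × Fin 3 → ℤ) (h : cenOKP c = true) (i j : Fin 3) :
    (((gbP c w).cz i j : ℕ) : ℤ) = cG c i j := by
  rw [(gbP_wz_cz c w i j).2]
  simp only [cenOKP, Bool.and_eq_true, decide_eq_true_eq] at h
  obtain ⟨⟨⟨⟨⟨⟨⟨⟨h00, h01⟩, h02⟩, h10⟩, h11⟩, h12⟩, h20⟩, h21⟩, h22⟩ := h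
  fin_cases i <;> fin_cases j
  · exact Int.toNat_of_nonneg h00
  · exact Int.toNat_of_nonneg h01
  · exact Int.toNat_of_nonneg h02
  · exact Int.toNat_of_nonneg h10
  · exact Int.toNat_of_nonneg h11
  · exact Int.toNat_of_nonneg h12
  · exact Int.toNat_of_nonneg h20
  · exact Int.toNat_of_nonneg h21
  · exact Int.toNat_of_nonneg h22

/-- `PNW` read in `ℝ`: `Σ_a |P_a|·Σ_b |n_b| w_ab`. [formal bookkeeping] -/
theorem PNW_cast {w : Fin 3 × Fin 3 → ℤ} (c : Fin 3 × Fin 3 → ℤ) (hw : ∀ ab, 0 ≤ w ab) (l : NL) :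
    ((PNW (epOf c w) l : ℕ) : ℝ) = ∑ a : Fin 3, ∑ b : Fin 3, |((PZ (epOf c w) l a : ℤ) : ℝ)| * |((nZ l b : ℤ) : ℝ)| * (w (a, b) : ℝ) := by
  have e : ∀ ab, (((w ab).toNat : ℕ) : ℝ) = ((w ab : ℤ) : ℝ) := fun ab => by exact_mod_cast Int.toNat_of_nonneg (hw ab)
  simp only [PNW, NW0, NW1, NW2, PZ, nZ, epOf, Fin.sum_univ_three, Nat.add_eq, Nat.mul_eq, Matrix.cons_val_zero, Matrix.cons_val_one,
    Matrix.cons_val_two, Matrix.head_cons, Matrix.tail_cons]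
  push_cast
  simp only [Nat.cast_natAbs, Int.cast_abs, e]
  ring

/-- ★ **THE RADIUS BOUND**: the theorem's radius of a record is at most `radP/SC`. [folklore] -/
theorem rv_le {c w : Fin 3 × Fin 3 → ℤ} (hw : ∀ ab, 0 ≤ w ab) {l : NL} (hl : l.ok = true) :
    (∑ k9' : Fin 9, |∑ k9 : Fin 9, ((l.toLab ((@finProdFinEquiv 3 3).symm k9).1 : ℝ) * (l.toLab ((@finProdFinEquiv 3 3).symm k9).2 : ℝ)) *
        Jf (OfR (fun ab => (c ab : ℝ) / SC)) ((@finProdFinEquiv 3 3).symm k9') ((@finProdFinEquiv 3 3).symm k9)| *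
        ((w ((@finProdFinEquiv 3 3).symm k9') : ℝ) / SC) +
      ∑ k9 : Fin 9, |((l.toLab ((@finProdFinEquiv 3 3).symm k9).1 : ℝ) * (l.toLab ((@finProdFinEquiv 3 3).symm k9).2 : ℝ))| *
        (((((gbP c w).wz ((@finProdFinEquiv 3 3).symm k9).1 ((@finProdFinEquiv 3 3).symm k9).2 : ℕ) : ℤ) : ℝ) / SC)) ≤
      ((radP (gbP c w).toLK (epOf c w) l : ℕ) : ℝ) / SC := by
  have hS := SC_pos
  rw [rad_real_eq hl (gbP c w)]
  -- the inner sums are the pulled-back functionals `(P_a/SC)·n_b`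
  have hinner : ∀ a b : Fin 3, ∑ k9 : Fin 9, ((l.toLab ((@finProdFinEquiv 3 3).symm k9).1 : ℝ) * (l.toLab ((@finProdFinEquiv 3 3).symm k9).2 : ℝ)) *
      Jf (OfR (fun ab => (c ab : ℝ) / SC)) (a, b) ((@finProdFinEquiv 3 3).symm k9) =
      ((PZ (epOf c w) l a : ℤ) : ℝ) / SC * ((nZ l b : ℤ) : ℝ) := by
    intro a b
    rw [sum_fin9 (fun i j => ((l.toLab i : ℝ) * (l.toLab j : ℝ)) * Jf (OfR (fun ab => (c ab : ℝ) / SC)) (a, b) (i, j)), sum_lab_Jf,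
      PZ_cast, nZ_eq, Finset.sum_div, Finset.sum_mul, Finset.sum_mul]
    refine Finset.sum_congr rfl fun cc _ => ?_
    ring
  have hfirst : ∑ k9' : Fin 9, |∑ k9 : Fin 9, ((l.toLab ((@finProdFinEquiv 3 3).symm k9).1 : ℝ) * (l.toLab ((@finProdFinEquiv 3 3).symm k9).2 : ℝ)) *
        Jf (OfR (fun ab => (c ab : ℝ) / SC)) ((@finProdFinEquiv 3 3).symm k9') ((@finProdFinEquiv 3 3).symm k9)| *
        ((w ((@finProdFinEquiv 3 3).symm k9') : ℝ) / SC) = ((PNW (epOf c w) l : ℕ) : ℝ) / SC ^ 2 := by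
    rw [sum_fin9 (fun a b => |∑ k9 : Fin 9, ((l.toLab ((@finProdFinEquiv 3 3).symm k9).1 : ℝ) * (l.toLab ((@finProdFinEquiv 3 3).symm k9).2 : ℝ)) *
        Jf (OfR (fun ab => (c ab : ℝ) / SC)) (a, b) ((@finProdFinEquiv 3 3).symm k9)| * ((w (a, b) : ℝ) / SC))]
    simp only [hinner]
    rw [PNW_cast c hw l, Finset.sum_div]
    refine Finset.sum_congr rfl fun a _ => ?_
    rw [Finset.sum_div]
    refine Finset.sum_congr rfl fun b _ => ?_
    rw [abs_mul, abs_div, abs_of_pos hS]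
    field_simp
  rw [hfirst]
  -- PNW/SC² ≤ r1/SC and assemble
  have hr1 : ((PNW (epOf c w) l : ℕ) : ℝ) / SC ^ 2 ≤ ((r1 (epOf c w) l : ℕ) : ℝ) / SC := by
    have h := nat_ceil_div (PNW (epOf c w) l) (D := SCN) (by rw [SCN_eq]; norm_num [SC])
    have e : r1 (epOf c w) l = (PNW (epOf c w) l + (SCN - 1)) / SCN := rfl
    rw [e, pow_two, ← div_div]
    have hSC : ((SCN : ℕ) : ℝ) = (SC : ℝ) := by rw [SCN_eq]
    rw [hSC] at h
    exact div_le_div_of_nonneg_right h hS.le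
  have e2 : ((radP (gbP c w).toLK (epOf c w) l : ℕ) : ℝ) / SC = ((rad (gbP c w).toLK l : ℕ) : ℝ) / SC + ((r1 (epOf c w) l : ℕ) : ℝ) / SC := by
    simp only [radP, Nat.add_eq]; push_cast; ring
  rw [e2]
  have e3 : ((((rad (gbP c w).toLK l : ℕ) : ℤ)) : ℝ) / SC = ((rad (gbP c w).toLK l : ℕ) : ℝ) / SC := by simp
  rw [e3]
  linarith

/-- ★ **THE PARAM ENCLOSURE OF A LABEL VALUE**: `|‖latPt U f b‖² − (qPos − qNeg)/SC| ≤ radP/SC` for `U` in the entry box. [folklore] -/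
theorem abs_q_sub_ell0_le (U : E3 →L[ℝ] E3) {c w : Fin 3 × Fin 3 → ℤ} (hcen : cenOKP c = true)
    (hbox : ∀ ab : Fin 3 × Fin 3, |(U (EuclideanSpace.single ab.2 (1 : ℝ))) ab.1 - (c ab : ℝ) / SC| ≤ (w ab : ℝ) / SC)
    {l : NL} (hl : l.ok = true) :
    |‖latPt U fccVec l.toLab‖ ^ 2 - ((((qPos (gbP c w).toLK l : ℕ) : ℤ) - ((qNeg (gbP c w).toLK l : ℕ) : ℤ) : ℤ) : ℝ) / SC| ≤
      ((radP (gbP c w).toLK (epOf c w) l : ℕ) : ℝ) / SC := by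
  have hw := w_nonneg_of_hbox hbox
  have hsq : ‖latPt U fccVec l.toLab‖ ^ 2 =
      ∑ k9 : Fin 9, ((l.toLab ((@finProdFinEquiv 3 3).symm k9).1 : ℝ) * (l.toLab ((@finProdFinEquiv 3 3).symm k9).2 : ℝ)) *
        ⟪U (fccVec ((@finProdFinEquiv 3 3).symm k9).1), U (fccVec ((@finProdFinEquiv 3 3).symm k9).2)⟫ := by
    rw [norm_sq_latPt_eq_sum_gram, ← sum_fin9 (fun i j => ((l.toLab i : ℝ) * (l.toLab j : ℝ)) * ⟪U (fccVec i), U (fccVec j)⟫)]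
  have hc0 : ∀ i j : Fin 3, (((gbP c w).cz i j : ℤ) : ℝ) / SC = ((cG c i j : ℤ) : ℝ) / SC := fun i j => by rw [gbP_cz_cast w hcen]
  rw [hsq, ← ell0_eq hl (gbP c w)]
  have h := abs_lin_param_le (n := 9) (q := 9)
    (fun k9 => ((l.toLab ((@finProdFinEquiv 3 3).symm k9).1 : ℝ) * (l.toLab ((@finProdFinEquiv 3 3).symm k9).2 : ℝ)))
    (fun k9 => ⟪U (fccVec ((@finProdFinEquiv 3 3).symm k9).1), U (fccVec ((@finProdFinEquiv 3 3).symm k9).2)⟫)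
    (fun k9 => (((gbP c w).cz ((@finProdFinEquiv 3 3).symm k9).1 ((@finProdFinEquiv 3 3).symm k9).2 : ℤ) : ℝ) / SC)
    (fun k9 => ((((gbP c w).wz ((@finProdFinEquiv 3 3).symm k9).1 ((@finProdFinEquiv 3 3).symm k9).2 : ℕ) : ℤ) : ℝ) / SC)
    (fun k9' k9 => Jf (OfR (fun ab => (c ab : ℝ) / SC)) ((@finProdFinEquiv 3 3).symm k9') ((@finProdFinEquiv 3 3).symm k9))
    (fun k9' => uE U ((@finProdFinEquiv 3 3).symm k9') - (c ((@finProdFinEquiv 3 3).symm k9') : ℝ) / SC)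
    (fun k9' => (w ((@finProdFinEquiv 3 3).symm k9') : ℝ) / SC)
    (fun k9' => hbox _)
    (fun k9 => by
      have hg := gram_paramP U hbox ((@finProdFinEquiv 3 3).symm k9).1 ((@finProdFinEquiv 3 3).symm k9).2
      rw [hc0, (gbP_wz_cz c w _ _).1]
      rw [sum_fin9 (fun a b => Jf (OfR (fun ab => (c ab : ℝ) / SC)) (a, b) (((@finProdFinEquiv 3 3).symm k9).1, ((@finProdFinEquiv 3 3).symm k9).2) *
        (uE U (a, b) - (c (a, b) : ℝ) / SC))]
      push_cast
      exact hg)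
  exact h.trans (rv_le hw hl)

/-- ★ **FAR BY THE PARAM ENCLOSURE**: a label with `81·SC ≤ 4·(q0 − radP)` has `‖latPt U f b‖ ≥ 9/2` for every `U` in the entry box. [folklore] -/
theorem far_of_farBP (U : E3 →L[ℝ] E3) {c w : Fin 3 × Fin 3 → ℤ} (hcen : cenOKP c = true)
    (hbox : ∀ ab : Fin 3 × Fin 3, |(U (EuclideanSpace.single ab.2 (1 : ℝ))) ab.1 - (c ab : ℝ) / SC| ≤ (w ab : ℝ) / SC)
    {l : NL} (hl : l.ok = true) (h1 : qNeg (gbP c w).toLK l + radP (gbP c w).toLK (epOf c w) l ≤ qPos (gbP c w).toLK l)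
    (hfar : farBR (gbP c w).toLK (radP (gbP c w).toLK (epOf c w)) l = true) : 9 / 2 ≤ ‖latPt U fccVec l.toLab‖ := by
  have hS := SC_pos
  have habs := abs_q_sub_ell0_le U hcen hbox hl
  set k := (gbP c w).toLK
  set R := radP k (epOf c w) l
  have hq : qNeg k l ≤ qPos k l := le_trans (Nat.le_add_right _ _) h1
  unfold farBR q0N at hfar
  have hfar' : 81 * SCN ≤ 4 * (qPos k l - qNeg k l - R) := by simpa [Nat.ble_eq, Nat.mul_eq] using hfar
  have hsub : R ≤ qPos k l - qNeg k l := by omega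
  have hR : (81 : ℝ) / 4 ≤ ((((qPos k l : ℕ) : ℤ) - ((qNeg k l : ℕ) : ℤ) : ℤ) : ℝ) / SC - ((R : ℕ) : ℝ) / SC := by
    rw [SCN_eq] at hfar'
    have : (81 : ℝ) * SC ≤ 4 * (((qPos k l - qNeg k l - R : ℕ) : ℝ)) := by exact_mod_cast hfar'
    rw [Nat.cast_sub hsub, Nat.cast_sub hq] at this
    push_cast
    rw [div_sub_div_same, le_div_iff₀ hS]
    linarith
  have hge : (81 : ℝ) / 4 ≤ ‖latPt U fccVec l.toLab‖ ^ 2 := by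
    have := (abs_le.1 habs).1
    linarith
  nlinarith [norm_nonneg (latPt U fccVec l.toLab)]

end Summit.AtomisticToContinuum.Crystallization.Theorems.FrustratedLawDichotomyStrainedPatchHomLeafTableCheck

end
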